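import Summits.CriticalPhenomena.PercolationContinuityZ3.Theorems.PercNearOneGluingNoHeavyLowerTailSuperTerminalP3LamPortPiecesTwo
import HarnessLib

/-!
# `P3_λ` (`λ ≥ 3/2`): every `{s,a,b,c}`-piece that misses `b` is irrelevant (cell algebra + Harris)

Support file for crux `stmt-CriticalPhenomena-4575` (`NoHeavyLowerTail`), seat `prim-l12-p1` gen 33 (`--supports stmt-CriticalPhenomena-4575`);
sequel of `…SuperTerminalP3LamPortPieces` / `…PortPiecesTwo`.  No definitions, no sorries, standard axioms.

Row `P3_λ`: `μ(F)·μ(c ↔ T) ≤ λ·μ(F ∩ c ↔ T)`, `F = {s↔a} ∩ {s↮b}`, `T = {s,a,b}` (sharp conjectured constant `λ = 3/2`).  A piece whose pairs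
avoid `b` (it may touch `c`, `s`, `a`: an arbitrary 3-terminal gadget between the port and the block `{s,a}`) has the down-set vector
`e = (n, n+p_sa, n+p_sa, n, 1, n+p_sc, n+p_ac, n+p_sa)` of its 3-point law on `{s,a,c}` (`dvec_bFreePiece`), and

* `dvec_p3lam_mul_bFree` — **for `λ ≥ 3/2`, `Core(d) ∧ Row_λ(d) ∧ Face(d)` and the HARRIS inequality `P(s∼a)·P(c∼{s,a}) ≤ P(s∼a∼c)` of the piece
  imply `Row_λ(d ⊙ e)`**, by an exact Farkas certificate: `(λ−1+γ)·Row_λ(d⊙e) = n(λ−1+γe₁)·R + p_sa(λ−1+γe₁)·Φ + Σ_c ν_c·c` over the seven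
  cells `c` of `d`, every multiplier a product of nonnegative quantities (`ν_{d0} ≥ 0` is where Harris enters; the quadratic
  `(λ−1)(λ−1+γ) − γ(1−γ) = (γ−(2−λ)/2)² + λ(3λ−4)/4 ≥ 0` is the one of `…PortTermPairs.pencil_row`).  The abstract statement is FALSE with
  Harris replaced by nothing or by the pair–pair form `P(s∼a)P(s∼c) ≤ P(s∼a∼c)` (exact counterexamples, memo
  `FROM-prim-l12-p1-g33-PORT-PART-SHARP-ROW.md` §7); contrast: pieces missing `a` (or `s`) are NOT abstractly gluable at `λ = 3/2`
  (the gen-31/32 two-piece counterexamples), pieces missing `b` ARE.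
* `dvec_bFreePiece` — the shape and the Harris inequality for every weight whose pairs avoid `b` (`Literature…prodBernoulli_harris`).
The assembly (`p3lam_of_portPieces₃`: pieces outside `J` may miss `c`, or miss `b`, or miss `{s,a}`) is `…SuperTerminalP3LamPortPiecesThree`.
-/

namespace Summit.CriticalPhenomena.PercolationContinuityZ3.Theorems.SuperTerminalP3LamBFreePieces

open MeasureTheory Set Filter
open Literature.Probability.Percolation Literature.Probability.Percolation.PartitionGluing
open Literature.Probability.LatticeModels (prodBernoulli prodBernoulli_harris)
open SuperTerminalDownsets SuperTerminalDownsetEvents SuperTerminalP3LamDvec SuperTerminalP3LamPortPieces SuperTerminalP3LamPortPiecesTwo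
open scoped Classical

variable {V : Type*} [Fintype V]

/-- The ORDER RELATIONS of a down-set vector (as in `…SuperTerminalP3LamDvec`).  Local notation only. -/
local notation "Core[" x0 "," x1 "," x2 "," x3 "," x4 "," x5 "," x6 "," x7 "]" =>
  (((0 : ℝ) ≤ x0 ∧ x0 ≤ x1 ∧ x0 ≤ x3 ∧ x0 ≤ x5 ∧ x0 ≤ x6 ∧ (0 : ℝ) ≤ x7 ∧ x7 ≤ 1 ∧
      (0 : ℝ) ≤ x2 - x3 - x1 + x0 ∧ (0 : ℝ) ≤ x4 - x5 - x6 + x0 - x1 + x0) : Prop)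

/-- The row `P3_λ` in down-set coordinates (as in `…SuperTerminalP3LamDvec`).  Local notation only. -/
local notation "RowLam[" lam ";" x0 "," x1 "," x2 "," x3 "," x4 "," x5 "," x6 "," x7 "]" =>
  (((x2 - x3 + x4 - x5 - x6 - x1 + 2 * x0) * (1 - x7) ≤ lam * (x2 - x3 + x4 - x5 - x6 - 2 * x1 + 3 * x0)) : Prop)

/-- The face inequality `(C½)` of the `sa`-glued graph in down-set coordinates (as in `…SuperTerminalP3LamDvec`).  Local notation only. -/
local notation "Face[" x1 "," x2 "," x4 "," x7 "]" => ((2 * (x2 + x4 - x1) * (1 - x7) ≤ 3 * (x2 + x4 - 2 * x1)) : Prop)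

/-! ## Cell algebra: the Farkas certificate -/

/-- **Gluing a `b`-free piece (cell level).**  For `λ ≥ 3/2`: let `d` satisfy the order relations, the row `P3_λ` and the face inequality, and let
`e = (e0, e1, e1, e0, 1, e5, e6, e1)` be the down-set vector of a piece whose pairs avoid `b` — a 3-point law on `{s,a,c}` with cells
`n = e0`, `p_sa = e1 − e0`, `p_sc = e5 − e0`, `p_ac = e6 − e0`, `p_all = 1 − e1 − e5 − e6 + 2e0` — satisfying the HARRIS inequality
`P(s∼a)·P(c∼{s,a}) ≤ P(s∼a∼c)`, i.e. `(1 − e5 − e6 + e0)(1 − e1) ≤ p_all`.  Then the coordinatewise product satisfies `P3_λ`.  Proof: the exact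
Farkas certificate `(λ−1+d7)·Row_λ(d⊙e) = n(A−γq)R + p_sa(A−γq)Φ + Σ_c ν_c·c` over the cells `c` of `d` (`A = λ−1+γ`, `q = 1−e1`; all
multipliers nonnegative, `ν_{d0} ≥ 0` by the Harris inequality of the piece and `(λ−1)(λ−1+γ) − γ(1−γ) = (γ−(2−λ)/2)² + λ(3λ−4)/4`). [this work] -/
theorem dvec_p3lam_mul_bFree {lam d0 d1 d2 d3 d4 d5 d6 d7 e0 e1 e2 e3 e4 e5 e6 e7 : ℝ} (hlam : 3 / 2 ≤ lam)
    (hd : Core[d0, d1, d2, d3, d4, d5, d6, d7]) (hP : RowLam[lam; d0, d1, d2, d3, d4, d5, d6, d7]) (hF : Face[d1, d2, d4, d7])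
    (h2 : e2 = e1) (h3 : e3 = e0) (h4 : e4 = 1) (h7 : e7 = e1)
    (he0 : 0 ≤ e0) (he01 : e0 ≤ e1) (he05 : e0 ≤ e5) (he06 : e0 ≤ e6) (he1 : e1 ≤ 1) (hall : 0 ≤ 1 - e1 - e5 - e6 + 2 * e0)
    (hH : (1 - e5 - e6 + e0) * (1 - e1) ≤ 1 - e1 - e5 - e6 + 2 * e0) :
    RowLam[lam; d0 * e0, d1 * e1, d2 * e2, d3 * e3, d4 * e4, d5 * e5, d6 * e6, d7 * e7] := by
  rw [h2, h3, h4, h7]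
  obtain ⟨g0, g1, g3, g5, g6, g7, g71, gζ, gτ⟩ := hd
  have hA : 0 < lam - 1 + d7 := by linarith
  have hR : 0 ≤ lam * (d2 - d3 + d4 - d5 - d6 - 2 * d1 + 3 * d0) - (d2 - d3 + d4 - d5 - d6 - d1 + 2 * d0) * (1 - d7) := by
    linarith
  have hpos : 0 ≤ d2 + d4 - 2 * d1 := by linarith
  have hPhi : 0 ≤ lam * (d2 + d4 - 2 * d1) - (d2 + d4 - d1) * (1 - d7) := by
    have h32 : 3 / 2 * (d2 + d4 - 2 * d1) ≤ lam * (d2 + d4 - 2 * d1) := mul_le_mul_of_nonneg_right hlam hpos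
    linarith
  -- the key quadratic: `(λ−1)(λ−1+γ) − γ(1−γ) ≥ 0` for `λ ≥ 4/3`
  have hQ : 0 ≤ (lam - 1) * (lam - 1 + d7) - d7 * (1 - d7) := by
    have e : (lam - 1) * (lam - 1 + d7) - d7 * (1 - d7) = (d7 - (2 - lam) / 2) ^ 2 + lam * (3 * lam - 4) / 4 := by ring
    rw [e]
    have : 0 ≤ lam * (3 * lam - 4) := mul_nonneg (by linarith) (by linarith)
    nlinarith [sq_nonneg (d7 - (2 - lam) / 2)]
  have hAq : 0 ≤ lam - 1 + d7 * e1 := by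
    have := mul_nonneg g7 (he0.trans he01)
    linarith
  have hQe : 0 ≤ (lam - 1) * (lam - 1 + d7) - (1 - d7) * d7 * e1 := by
    have : (1 - d7) * d7 * e1 ≤ (1 - d7) * d7 := by
      have h := mul_le_mul_of_nonneg_left he1 (mul_nonneg (sub_nonneg.2 g71) g7)
      simpa using h
    linarith
  -- Harris in the form `p_sa·q ≤ p_all·e1`
  have hH' : (e1 - e0) * (1 - e1) ≤ (1 - e1 - e5 - e6 + 2 * e0) * e1 := by
    have e : (1 - e1 - e5 - e6 + 2 * e0) * e1 - (e1 - e0) * (1 - e1) =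
        (1 - e1 - e5 - e6 + 2 * e0) - (1 - e5 - e6 + e0) * (1 - e1) := by ring
    linarith
  -- the seven nonnegative terms of the certificate
  have t1 : 0 ≤ e0 * (lam - 1 + d7 * e1) *
      (lam * (d2 - d3 + d4 - d5 - d6 - 2 * d1 + 3 * d0) - (d2 - d3 + d4 - d5 - d6 - d1 + 2 * d0) * (1 - d7)) :=
    mul_nonneg (mul_nonneg he0 hAq) hR
  have t2 : 0 ≤ (e1 - e0) * (lam - 1 + d7 * e1) * (lam * (d2 + d4 - 2 * d1) - (d2 + d4 - d1) * (1 - d7)) :=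
    mul_nonneg (mul_nonneg (sub_nonneg.2 he01) hAq) hPhi
  have t3 : 0 ≤ (1 - e1) * ((lam - 1) * (lam - 1 + d7) - (1 - d7) * d7 * e1) * (d1 - d0) :=
    mul_nonneg (mul_nonneg (sub_nonneg.2 he1) hQe) (sub_nonneg.2 g1)
  have t4 : 0 ≤ (lam - 1 + d7) * ((lam - 1) * (1 - e1) + e1 * d7 * (1 - e1)) * (d4 - d5 - d6 + d0 - d1 + d0) :=
    mul_nonneg (mul_nonneg hA.le (add_nonneg (mul_nonneg (by linarith) (sub_nonneg.2 he1))
      (mul_nonneg (mul_nonneg (he0.trans he01) g7) (sub_nonneg.2 he1)))) gτ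
  have hA0 : 0 ≤ lam - 1 + d7 * e0 := by
    have := mul_nonneg g7 he0
    linarith
  have t5 : 0 ≤ (lam - 1 + d7) * (d7 * (e1 - e0) * ((e6 - e0) + (1 - e1 - e5 - e6 + 2 * e0)) +
      (lam - 1 + d7 * e0) * ((e6 - e0) + (1 - e1 - e5 - e6 + 2 * e0))) * (d5 - d0) := by
    have hx : 0 ≤ (e6 - e0) + (1 - e1 - e5 - e6 + 2 * e0) := add_nonneg (sub_nonneg.2 he06) hall
    refine mul_nonneg (mul_nonneg hA.le (add_nonneg ?_ ?_)) (sub_nonneg.2 g5)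
    · exact mul_nonneg (mul_nonneg g7 (sub_nonneg.2 he01)) hx
    · exact mul_nonneg hA0 hx
  have t6 : 0 ≤ (lam - 1 + d7) * (d7 * (e1 - e0) * ((e5 - e0) + (1 - e1 - e5 - e6 + 2 * e0)) +
      (lam - 1 + d7 * e0) * ((e5 - e0) + (1 - e1 - e5 - e6 + 2 * e0))) * (d6 - d0) := by
    have hx : 0 ≤ (e5 - e0) + (1 - e1 - e5 - e6 + 2 * e0) := add_nonneg (sub_nonneg.2 he05) hall
    refine mul_nonneg (mul_nonneg hA.le (add_nonneg ?_ ?_)) (sub_nonneg.2 g6)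
    · exact mul_nonneg (mul_nonneg g7 (sub_nonneg.2 he01)) hx
    · exact mul_nonneg hA0 hx
  have t7 : 0 ≤ ((lam - 1 + d7) * (1 - e1 - e5 - e6 + 2 * e0) * (lam - 1 + d7 * e1) - lam * d7 * (e1 - e0) * (1 - e1)) * d0 := by
    refine mul_nonneg ?_ g0
    -- `λγ·p_sa·q ≤ λγ·p_all·e1` by Harris, then the key quadratic
    have h1 : lam * d7 * ((e1 - e0) * (1 - e1)) ≤ lam * d7 * ((1 - e1 - e5 - e6 + 2 * e0) * e1) :=
      mul_le_mul_of_nonneg_left hH' (mul_nonneg (by linarith) g7)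
    have h2 : 0 ≤ (1 - e1 - e5 - e6 + 2 * e0) * ((lam - 1) * (lam - 1 + d7) - (1 - d7) * d7 * e1) := mul_nonneg hall hQe
    have e : (lam - 1 + d7) * (1 - e1 - e5 - e6 + 2 * e0) * (lam - 1 + d7 * e1) - lam * d7 * (e1 - e0) * (1 - e1) =
        (1 - e1 - e5 - e6 + 2 * e0) * ((lam - 1) * (lam - 1 + d7) - (1 - d7) * d7 * e1) +
          (lam * d7 * ((1 - e1 - e5 - e6 + 2 * e0) * e1) - lam * d7 * ((e1 - e0) * (1 - e1))) := by ring
    rw [e]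
    linarith
  -- the certificate identity
  have key : (lam - 1 + d7) * (lam * (d2 * e1 - d3 * e0 + d4 * 1 - d5 * e5 - d6 * e6 - 2 * (d1 * e1) + 3 * (d0 * e0)) -
      (d2 * e1 - d3 * e0 + d4 * 1 - d5 * e5 - d6 * e6 - d1 * e1 + 2 * (d0 * e0)) * (1 - d7 * e1)) =
      e0 * (lam - 1 + d7 * e1) *
          (lam * (d2 - d3 + d4 - d5 - d6 - 2 * d1 + 3 * d0) - (d2 - d3 + d4 - d5 - d6 - d1 + 2 * d0) * (1 - d7)) +
        (e1 - e0) * (lam - 1 + d7 * e1) * (lam * (d2 + d4 - 2 * d1) - (d2 + d4 - d1) * (1 - d7)) +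
        (1 - e1) * ((lam - 1) * (lam - 1 + d7) - (1 - d7) * d7 * e1) * (d1 - d0) +
        (lam - 1 + d7) * ((lam - 1) * (1 - e1) + e1 * d7 * (1 - e1)) * (d4 - d5 - d6 + d0 - d1 + d0) +
        (lam - 1 + d7) * (d7 * (e1 - e0) * ((e6 - e0) + (1 - e1 - e5 - e6 + 2 * e0)) +
          (lam - 1 + d7 * e0) * ((e6 - e0) + (1 - e1 - e5 - e6 + 2 * e0))) * (d5 - d0) +
        (lam - 1 + d7) * (d7 * (e1 - e0) * ((e5 - e0) + (1 - e1 - e5 - e6 + 2 * e0)) +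
          (lam - 1 + d7 * e0) * ((e5 - e0) + (1 - e1 - e5 - e6 + 2 * e0))) * (d6 - d0) +
        ((lam - 1 + d7) * (1 - e1 - e5 - e6 + 2 * e0) * (lam - 1 + d7 * e1) - lam * d7 * (e1 - e0) * (1 - e1)) * d0 := by
    ring
  have hsum : 0 ≤ (lam - 1 + d7) * (lam * (d2 * e1 - d3 * e0 + d4 * 1 - d5 * e5 - d6 * e6 - 2 * (d1 * e1) + 3 * (d0 * e0)) -
      (d2 * e1 - d3 * e0 + d4 * 1 - d5 * e5 - d6 * e6 - d1 * e1 + 2 * (d0 * e0)) * (1 - d7 * e1)) := by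
    rw [key]; linarith
  by_contra hneg
  have : (lam - 1 + d7) * (lam * (d2 * e1 - d3 * e0 + d4 * 1 - d5 * e5 - d6 * e6 - 2 * (d1 * e1) + 3 * (d0 * e0)) -
      (d2 * e1 - d3 * e0 + d4 * 1 - d5 * e5 - d6 * e6 - d1 * e1 + 2 * (d0 * e0)) * (1 - d7 * e1)) < 0 :=
    mul_neg_of_pos_of_neg hA (by linarith)
  linarith


/-! ## The down-set vector and the Harris inequality of a piece missing `b` -/

section Shape
variable {s a b c : V}

/-- **`b`-free shape.**  If the pairs of `u` avoid `b`, then in the down-set coordinates `e0..e7` of `u`: `e2 = e1`, `e3 = e0`, `e4 = 1`,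
`e7 = e1`, `e1 ≤ 1`, and — writing `p_all = 1 − e1 − e5 − e6 + 2e0 = P_u(s∼a∼c)`, `P_u(s∼a) = 1 − e5 − e6 + e0`, `P_u(c∼{s,a}) = 1 − e1` —
`0 ≤ p_all` and the Harris inequality `(1 − e5 − e6 + e0)(1 − e1) ≤ p_all` (`prodBernoulli_harris` for the increasing events `{s∼a}` and
`{c∼s} ∪ {c∼a}`). [this work] -/
theorem dvec_bFreePiece (u : Sym2 V → unitInterval) (hd : s ≠ a ∧ s ≠ b ∧ s ≠ c ∧ a ≠ b ∧ a ≠ c ∧ b ≠ c)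
    (hb : ∀ x : V, x ≠ b → (u s(b, x) : ℝ) = 0) :
    (prodBernoulli u).real ((openConn s b)ᶜ ∩ (openConn s c)ᶜ ∩ (openConn a b)ᶜ ∩ (openConn a c)ᶜ : Set (BondConfig V)) =
        (prodBernoulli u).real ((openConn s b)ᶜ ∩ (openConn s c)ᶜ ∩ (openConn a b)ᶜ ∩ (openConn a c)ᶜ ∩ (openConn b c)ᶜ : Set (BondConfig V)) ∧
      (prodBernoulli u).real ((openConn s a)ᶜ ∩ (openConn s b)ᶜ ∩ (openConn s c)ᶜ ∩ (openConn a b)ᶜ ∩ (openConn a c)ᶜ : Set (BondConfig V)) =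
        (prodBernoulli u).real
          ((openConn s a)ᶜ ∩ (openConn s b)ᶜ ∩ (openConn s c)ᶜ ∩ (openConn a b)ᶜ ∩ (openConn a c)ᶜ ∩ (openConn b c)ᶜ : Set (BondConfig V)) ∧
      (prodBernoulli u).real ((openConn s b)ᶜ ∩ (openConn a b)ᶜ ∩ (openConn b c)ᶜ : Set (BondConfig V)) = 1 ∧
      (prodBernoulli u).real ((openConn c s)ᶜ ∩ (openConn c a)ᶜ ∩ (openConn c b)ᶜ : Set (BondConfig V)) =
        (prodBernoulli u).real ((openConn s b)ᶜ ∩ (openConn s c)ᶜ ∩ (openConn a b)ᶜ ∩ (openConn a c)ᶜ ∩ (openConn b c)ᶜ : Set (BondConfig V)) ∧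
      (prodBernoulli u).real ((openConn s b)ᶜ ∩ (openConn s c)ᶜ ∩ (openConn a b)ᶜ ∩ (openConn a c)ᶜ ∩ (openConn b c)ᶜ : Set (BondConfig V)) ≤ 1 ∧
      0 ≤ 1 - (prodBernoulli u).real ((openConn s b)ᶜ ∩ (openConn s c)ᶜ ∩ (openConn a b)ᶜ ∩ (openConn a c)ᶜ ∩ (openConn b c)ᶜ : Set (BondConfig V)) -
        (prodBernoulli u).real ((openConn s a)ᶜ ∩ (openConn s b)ᶜ ∩ (openConn a b)ᶜ ∩ (openConn a c)ᶜ ∩ (openConn b c)ᶜ : Set (BondConfig V)) -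
        (prodBernoulli u).real ((openConn s a)ᶜ ∩ (openConn s b)ᶜ ∩ (openConn s c)ᶜ ∩ (openConn a b)ᶜ ∩ (openConn b c)ᶜ : Set (BondConfig V)) +
        2 * (prodBernoulli u).real
          ((openConn s a)ᶜ ∩ (openConn s b)ᶜ ∩ (openConn s c)ᶜ ∩ (openConn a b)ᶜ ∩ (openConn a c)ᶜ ∩ (openConn b c)ᶜ : Set (BondConfig V)) ∧
      (1 - (prodBernoulli u).real ((openConn s a)ᶜ ∩ (openConn s b)ᶜ ∩ (openConn a b)ᶜ ∩ (openConn a c)ᶜ ∩ (openConn b c)ᶜ : Set (BondConfig V)) -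
          (prodBernoulli u).real ((openConn s a)ᶜ ∩ (openConn s b)ᶜ ∩ (openConn s c)ᶜ ∩ (openConn a b)ᶜ ∩ (openConn b c)ᶜ : Set (BondConfig V)) +
          (prodBernoulli u).real
            ((openConn s a)ᶜ ∩ (openConn s b)ᶜ ∩ (openConn s c)ᶜ ∩ (openConn a b)ᶜ ∩ (openConn a c)ᶜ ∩ (openConn b c)ᶜ : Set (BondConfig V))) *
        (1 - (prodBernoulli u).real ((openConn s b)ᶜ ∩ (openConn s c)ᶜ ∩ (openConn a b)ᶜ ∩ (openConn a c)ᶜ ∩ (openConn b c)ᶜ : Set (BondConfig V))) ≤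
      1 - (prodBernoulli u).real ((openConn s b)ᶜ ∩ (openConn s c)ᶜ ∩ (openConn a b)ᶜ ∩ (openConn a c)ᶜ ∩ (openConn b c)ᶜ : Set (BondConfig V)) -
        (prodBernoulli u).real ((openConn s a)ᶜ ∩ (openConn s b)ᶜ ∩ (openConn a b)ᶜ ∩ (openConn a c)ᶜ ∩ (openConn b c)ᶜ : Set (BondConfig V)) -
        (prodBernoulli u).real ((openConn s a)ᶜ ∩ (openConn s b)ᶜ ∩ (openConn s c)ᶜ ∩ (openConn a b)ᶜ ∩ (openConn b c)ᶜ : Set (BondConfig V)) +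
        2 * (prodBernoulli u).real
          ((openConn s a)ᶜ ∩ (openConn s b)ᶜ ∩ (openConn s c)ᶜ ∩ (openConn a b)ᶜ ∩ (openConn a c)ᶜ ∩ (openConn b c)ᶜ : Set (BondConfig V)) := by
  -- `b` is a.s. isolated
  have hae : ∀ᵐ ω ∂(prodBernoulli u), (¬ (openGraph ω).Reachable b s ∧ ¬ (openGraph ω).Reachable s b) ∧
      (¬ (openGraph ω).Reachable b a ∧ ¬ (openGraph ω).Reachable a b) ∧ (¬ (openGraph ω).Reachable b c ∧ ¬ (openGraph ω).Reachable c b) := by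
    filter_upwards [ae_sep_of_isolated u hb hd.2.1, ae_sep_of_isolated u hb hd.2.2.2.1, ae_sep_of_isolated u hb hd.2.2.2.2.2.symm]
      with ω h1 h2 h3
    exact ⟨h1, h2, h3⟩
  -- the 3-point events of `{s,a,c}`
  have Y : ∀ (X Z : Set (BondConfig V)), (∀ ω : BondConfig V, ((¬ (openGraph ω).Reachable b s ∧ ¬ (openGraph ω).Reachable s b) ∧
      (¬ (openGraph ω).Reachable b a ∧ ¬ (openGraph ω).Reachable a b) ∧ (¬ (openGraph ω).Reachable b c ∧ ¬ (openGraph ω).Reachable c b)) →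
      (ω ∈ X ↔ ω ∈ Z)) → (prodBernoulli u).real X = (prodBernoulli u).real Z := fun X Z hX =>
    real_congr_of_ae u (by filter_upwards [hae] with ω hω; exact hX ω hω)
  have hcs : ∀ ω : BondConfig V, (openGraph ω).Reachable c s ↔ (openGraph ω).Reachable s c := fun ω => ⟨fun h => h.symm, fun h => h.symm⟩
  have hca : ∀ ω : BondConfig V, (openGraph ω).Reachable c a ↔ (openGraph ω).Reachable a c := fun ω => ⟨fun h => h.symm, fun h => h.symm⟩
  have E1 : (prodBernoulli u).real ((openConn s b)ᶜ ∩ (openConn s c)ᶜ ∩ (openConn a b)ᶜ ∩ (openConn a c)ᶜ ∩ (openConn b c)ᶜ : Set (BondConfig V)) =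
      (prodBernoulli u).real ((openConn s c)ᶜ ∩ (openConn a c)ᶜ : Set (BondConfig V)) :=
    Y _ _ fun ω hω => by simp only [mem_inter_iff, mem_compl_iff, openConn, mem_setOf_eq]; tauto
  have E2 : (prodBernoulli u).real ((openConn s b)ᶜ ∩ (openConn s c)ᶜ ∩ (openConn a b)ᶜ ∩ (openConn a c)ᶜ : Set (BondConfig V)) =
      (prodBernoulli u).real ((openConn s c)ᶜ ∩ (openConn a c)ᶜ : Set (BondConfig V)) :=
    Y _ _ fun ω hω => by simp only [mem_inter_iff, mem_compl_iff, openConn, mem_setOf_eq]; tauto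
  have E7 : (prodBernoulli u).real ((openConn c s)ᶜ ∩ (openConn c a)ᶜ ∩ (openConn c b)ᶜ : Set (BondConfig V)) = (prodBernoulli u).real ((openConn s c)ᶜ ∩ (openConn a c)ᶜ : Set (BondConfig V)) :=
    Y _ _ fun ω hω => by simp only [mem_inter_iff, mem_compl_iff, openConn, mem_setOf_eq, hcs ω, hca ω]; tauto
  have E0 : (prodBernoulli u).real
      ((openConn s a)ᶜ ∩ (openConn s b)ᶜ ∩ (openConn s c)ᶜ ∩ (openConn a b)ᶜ ∩ (openConn a c)ᶜ ∩ (openConn b c)ᶜ : Set (BondConfig V)) =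
      (prodBernoulli u).real ((openConn s a)ᶜ ∩ (openConn s c)ᶜ ∩ (openConn a c)ᶜ : Set (BondConfig V)) :=
    Y _ _ fun ω hω => by simp only [mem_inter_iff, mem_compl_iff, openConn, mem_setOf_eq]; tauto
  have E3 : (prodBernoulli u).real ((openConn s a)ᶜ ∩ (openConn s b)ᶜ ∩ (openConn s c)ᶜ ∩ (openConn a b)ᶜ ∩ (openConn a c)ᶜ : Set (BondConfig V)) =
      (prodBernoulli u).real ((openConn s a)ᶜ ∩ (openConn s c)ᶜ ∩ (openConn a c)ᶜ : Set (BondConfig V)) :=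
    Y _ _ fun ω hω => by simp only [mem_inter_iff, mem_compl_iff, openConn, mem_setOf_eq]; tauto
  have E5 : (prodBernoulli u).real ((openConn s a)ᶜ ∩ (openConn s b)ᶜ ∩ (openConn a b)ᶜ ∩ (openConn a c)ᶜ ∩ (openConn b c)ᶜ : Set (BondConfig V)) =
      (prodBernoulli u).real ((openConn s a)ᶜ ∩ (openConn a c)ᶜ : Set (BondConfig V)) :=
    Y _ _ fun ω hω => by simp only [mem_inter_iff, mem_compl_iff, openConn, mem_setOf_eq]; tauto
  have E6 : (prodBernoulli u).real ((openConn s a)ᶜ ∩ (openConn s b)ᶜ ∩ (openConn s c)ᶜ ∩ (openConn a b)ᶜ ∩ (openConn b c)ᶜ : Set (BondConfig V)) =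
      (prodBernoulli u).real ((openConn s a)ᶜ ∩ (openConn s c)ᶜ : Set (BondConfig V)) :=
    Y _ _ fun ω hω => by simp only [mem_inter_iff, mem_compl_iff, openConn, mem_setOf_eq]; tauto
  have E4 : (prodBernoulli u).real ((openConn s b)ᶜ ∩ (openConn a b)ᶜ ∩ (openConn b c)ᶜ : Set (BondConfig V)) = 1 :=
    real_eq_one_of_ae u (by
      filter_upwards [hae] with ω hω
      simp only [mem_inter_iff, mem_compl_iff, openConn, mem_setOf_eq]
      exact ⟨⟨hω.1.2, hω.2.1.2⟩, hω.2.2.1⟩)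
  -- event algebra on `{s,a,c}`: `(s∼a)ᶜ = ((openConn s a)ᶜ ∩ (openConn a c)ᶜ : Set (BondConfig V)) ∪ ((openConn s a)ᶜ ∩ (openConn s c)ᶜ : Set (BondConfig V))`, `((openConn s a)ᶜ ∩ (openConn a c)ᶜ : Set (BondConfig V)) ∩ ((openConn s a)ᶜ ∩ (openConn s c)ᶜ : Set (BondConfig V)) = ((openConn s a)ᶜ ∩ (openConn s c)ᶜ ∩ (openConn a c)ᶜ : Set (BondConfig V))`, `(s∼a)ᶜ ∩ ((openConn s c)ᶜ ∩ (openConn a c)ᶜ : Set (BondConfig V)) = ((openConn s a)ᶜ ∩ (openConn s c)ᶜ ∩ (openConn a c)ᶜ : Set (BondConfig V))`, `(c∼s ∪ c∼a)ᶜ = ((openConn s c)ᶜ ∩ (openConn a c)ᶜ : Set (BondConfig V))`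
  have hsaC : ((openConn s a)ᶜ : Set (BondConfig V)) = ((openConn s a)ᶜ ∩ (openConn a c)ᶜ : Set (BondConfig V)) ∪ ((openConn s a)ᶜ ∩ (openConn s c)ᶜ : Set (BondConfig V)) := by
    ext ω
    simp only [mem_compl_iff, mem_union, mem_inter_iff, openConn, mem_setOf_eq]
    constructor
    · intro h
      by_cases hac : (openGraph ω).Reachable a c
      · exact Or.inr ⟨h, fun hsc => h (hsc.trans hac.symm)⟩
      · exact Or.inl ⟨h, hac⟩
    · rintro (⟨h, -⟩ | ⟨h, -⟩) <;> exact h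
  have h56 : ((openConn s a)ᶜ ∩ (openConn a c)ᶜ : Set (BondConfig V)) ∩ ((openConn s a)ᶜ ∩ (openConn s c)ᶜ : Set (BondConfig V)) = ((openConn s a)ᶜ ∩ (openConn s c)ᶜ ∩ (openConn a c)ᶜ : Set (BondConfig V)) := by
    ext ω; simp only [mem_inter_iff, mem_compl_iff]; tauto
  have hsa1 : ((openConn s a)ᶜ : Set (BondConfig V)) ∩ ((openConn s c)ᶜ ∩ (openConn a c)ᶜ : Set (BondConfig V)) = ((openConn s a)ᶜ ∩ (openConn s c)ᶜ ∩ (openConn a c)ᶜ : Set (BondConfig V)) := by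
    ext ω; simp only [mem_inter_iff, mem_compl_iff]; tauto
  have hcup : ((openConn c s ∪ openConn c a)ᶜ : Set (BondConfig V)) = ((openConn s c)ᶜ ∩ (openConn a c)ᶜ : Set (BondConfig V)) := by
    ext ω
    simp only [compl_union, mem_inter_iff, mem_compl_iff, openConn, mem_setOf_eq, hcs ω, hca ω]
  -- measures
  have m_sa : (prodBernoulli u).real (openConn s a : Set (BondConfig V)) =
      1 - ((prodBernoulli u).real ((openConn s a)ᶜ ∩ (openConn a c)ᶜ : Set (BondConfig V)) + (prodBernoulli u).real ((openConn s a)ᶜ ∩ (openConn s c)ᶜ : Set (BondConfig V)) - (prodBernoulli u).real ((openConn s a)ᶜ ∩ (openConn s c)ᶜ ∩ (openConn a c)ᶜ : Set (BondConfig V))) := by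
    have h1 := measureReal_add_measureReal_compl (μ := prodBernoulli u) (s := (openConn s a : Set (BondConfig V))) MeasurableSet.of_discrete
    have h2 := measureReal_union_add_inter (μ := prodBernoulli u) (s := ((openConn s a)ᶜ ∩ (openConn a c)ᶜ : Set (BondConfig V))) (t := ((openConn s a)ᶜ ∩ (openConn s c)ᶜ : Set (BondConfig V))) MeasurableSet.of_discrete
    rw [probReal_univ] at h1
    rw [h56] at h2
    rw [hsaC] at h1
    linarith
  have m_cup : (prodBernoulli u).real (openConn c s ∪ openConn c a : Set (BondConfig V)) = 1 - (prodBernoulli u).real ((openConn s c)ᶜ ∩ (openConn a c)ᶜ : Set (BondConfig V)) := by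
    have h1 := measureReal_add_measureReal_compl (μ := prodBernoulli u) (s := (openConn c s ∪ openConn c a : Set (BondConfig V)))
      MeasurableSet.of_discrete
    rw [probReal_univ, hcup] at h1
    linarith
  have m_all : (prodBernoulli u).real ((openConn s a : Set (BondConfig V)) ∩ (openConn c s ∪ openConn c a)) =
      1 - (prodBernoulli u).real ((openConn s c)ᶜ ∩ (openConn a c)ᶜ : Set (BondConfig V)) - (prodBernoulli u).real ((openConn s a)ᶜ ∩ (openConn a c)ᶜ : Set (BondConfig V)) - (prodBernoulli u).real ((openConn s a)ᶜ ∩ (openConn s c)ᶜ : Set (BondConfig V)) + 2 * (prodBernoulli u).real ((openConn s a)ᶜ ∩ (openConn s c)ᶜ ∩ (openConn a c)ᶜ : Set (BondConfig V)) := by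
    have h1 := measureReal_add_measureReal_compl (μ := prodBernoulli u)
      (s := ((openConn s a : Set (BondConfig V)) ∩ (openConn c s ∪ openConn c a))) MeasurableSet.of_discrete
    rw [probReal_univ, compl_inter, hcup] at h1
    have h2 := measureReal_union_add_inter (μ := prodBernoulli u) (s := ((openConn s a)ᶜ : Set (BondConfig V))) (t := ((openConn s c)ᶜ ∩ (openConn a c)ᶜ : Set (BondConfig V)))
      MeasurableSet.of_discrete
    rw [hsa1] at h2
    have h3 := measureReal_add_measureReal_compl (μ := prodBernoulli u) (s := (openConn s a : Set (BondConfig V))) MeasurableSet.of_discrete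
    rw [probReal_univ] at h3
    linarith
  -- Harris for `{s∼a}` and `{c∼s} ∪ {c∼a}`
  have hH := prodBernoulli_harris u (isUpperSet_openConn s a) ((isUpperSet_openConn c s).union (isUpperSet_openConn c a))
    MeasurableSet.of_discrete MeasurableSet.of_discrete
  rw [m_sa, m_cup, m_all] at hH
  have hle : (prodBernoulli u).real ((openConn s c)ᶜ ∩ (openConn a c)ᶜ : Set (BondConfig V)) ≤ 1 := measureReal_le_one
  have hall : 0 ≤ 1 - (prodBernoulli u).real ((openConn s c)ᶜ ∩ (openConn a c)ᶜ : Set (BondConfig V)) - (prodBernoulli u).real ((openConn s a)ᶜ ∩ (openConn a c)ᶜ : Set (BondConfig V)) - (prodBernoulli u).real ((openConn s a)ᶜ ∩ (openConn s c)ᶜ : Set (BondConfig V)) + 2 * (prodBernoulli u).real ((openConn s a)ᶜ ∩ (openConn s c)ᶜ ∩ (openConn a c)ᶜ : Set (BondConfig V)) := by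
    rw [← m_all]; exact measureReal_nonneg
  refine ⟨E2.trans E1.symm, E3.trans E0.symm, E4, E7.trans E1.symm, ?_, ?_, ?_⟩
  · rw [E1]; exact hle
  · rw [E1, E5, E6, E0]; exact hall
  · rw [E1, E5, E6, E0]
    have e : (1 - (prodBernoulli u).real ((openConn s a)ᶜ ∩ (openConn a c)ᶜ : Set (BondConfig V)) - (prodBernoulli u).real ((openConn s a)ᶜ ∩ (openConn s c)ᶜ : Set (BondConfig V)) + (prodBernoulli u).real ((openConn s a)ᶜ ∩ (openConn s c)ᶜ ∩ (openConn a c)ᶜ : Set (BondConfig V))) *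
        (1 - (prodBernoulli u).real ((openConn s c)ᶜ ∩ (openConn a c)ᶜ : Set (BondConfig V))) =
        (1 - ((prodBernoulli u).real ((openConn s a)ᶜ ∩ (openConn a c)ᶜ : Set (BondConfig V)) + (prodBernoulli u).real ((openConn s a)ᶜ ∩ (openConn s c)ᶜ : Set (BondConfig V)) - (prodBernoulli u).real ((openConn s a)ᶜ ∩ (openConn s c)ᶜ ∩ (openConn a c)ᶜ : Set (BondConfig V)))) *
        (1 - (prodBernoulli u).real ((openConn s c)ᶜ ∩ (openConn a c)ᶜ : Set (BondConfig V))) := by ring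
    rw [e]; exact hH

end Shape

end Summit.CriticalPhenomena.PercolationContinuityZ3.Theorems.SuperTerminalP3LamBFreePieces
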